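import Summits.QuantumFields.BalabanUV.T4Continuum.Spine.NE1p.DressedRebornMuResponse
import Summits.QuantumFields.BalabanUV.T4Continuum.Spine.NE1p.DressedRebornMuPartWitness

/-!
# T⁴ programme, spine estimate NE1′ (node O3b/H2) — WITNESS «THE RESPONSE OF THE RE-BORN PART FIRES ON THE EXP-LINEAR DATUM — AND IS A
# DIFFERENCE OF LOGARITHMIC DERIVATIVES»: S61 §2's `rebornMuDeriv_locE_le_of_expLinear` (leaf-03 g14) APPLIED ONCE BY NAME — its decided
# applier — on W84's bi-pencil reading `actB` of W31's one-term family `c·e^{h}`; the source derivative of the content-sourced part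
# `∂_m (E(m,1) − E(m,0))` IS `a·w₀·(A₁∕(1+A₁) − A₀∕(1+A₀))` with `A_s(m) = c·e^{(m·a+s)·w₀}` (the derivative of `E = log(1 + A)` read off
# `exp E = 1 + A` by the chain rule and the uniqueness of derivatives — no branch of `log` chosen), `A₁ − A₀ = c·e^{μaw₀}·(e^{w₀} − 1)`, so
# the response VANISHES AT A SOURCE `μ` IFF `a·w₀ = 0` — it is LIVE at EVERY source of the disc as soon as the source direction and the
# content are both live

Cell `pub-balaban`, sub-cell `t4`, row NE1′ formalisation crew (`t4/formal/NE1p/LEAVES.md` row W92 ∕ DAG N29zzzzzd — BOOKED typer R-T150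
`HOME/CLAIMS.log` l.24340, INTENT l.24200, LANDED p243723 l.24632, cross-read X234 ok (leaf-03-g15) 2026-08-21), unit
`b2b-balaban-t4-ne1p-formalise-leaf-06` (LEAF PROVER 06, gen 13; W84's author — its RESPONSE sequel).  ADDITIVE — imports
S61 `Spine/NE1p/DressedRebornMuResponse` (leaf-03 g14; → S56 → S33) and W84 `Spine/NE1p/DressedRebornMuPartWitness` (this seat, p241465;
→ W31 `DressedSmallFieldOnCoresWitness`, W24) ONLY — both LANDED; THEOREMS ONLY (0 def — W84's toy DATA `actB` BY NAME —, 0 `def … : Prop`,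
0 cite, 0 sorry); nothing of S61 ∕ S56 ∕ S33 ∕ W84 ∕ W31 ∕ W24 is restated — `rebornMuDeriv_locE_le_of_expLinear`,
`analytic_and_bounded_locE_param_of_expLinear` (S33 §2, ONCE, for the differentiability of the dressed output along the bi-pencil),
W84's `actB`∕`actB_X₀`∕`mem_pencilDisc`∕`differentiableOn_bipencil`∕`corners_mem`∕`norm_exponents_le`, W31's `termHistExpLinear_wTerm`∕`hK`∕`hR`∕
`hact`∕`cW`∕`cW_pos`∕`hL3`∕`norm_wLam_le`∕`norm_actW_X₀_lt_one`∕`exp_locE_actW`∕`eq_zero_of_exp_eq_one`, W24's `X₀`∕`hsmall_torus`∕`hrate_torus`∕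
`prefactor_pos`, `torus_consts`∕`K₀_four` are used BY NAME.

WHY.  S61 (leaf-03 g14) is the DERIVATIVE twin of S56: the source derivative of what a family's content regenerates, bounded on the
window `‖μ‖ ≤ μ₀ < μ₁` by `2·((2M∕ε)·σ)∕(μ₁ − μ₀)` (Schwarz in the strength at every source, Cauchy off-centre in the source), with (B1a)
discharged at the exp-linear level (§2) and at the cores (§3).  Its ENDs have no applier (tree grep at INTENT).  W84 (this seat) fired
S56 §2 on W31's datum along the bi-pencil `h = (z.1·a + z.2)·w₀` and found the cross-ratio; here the SAME datum carries S61 §2, and the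
response is computed EXACTLY:
* §1 **`responseEnd_fires`** — S61 §2 `rebornMuDeriv_locE_le_of_expLinear` APPLIED ONCE BY NAME with W84's plumbing VERBATIM
  (`hexp := termHistExpLinear_wTerm`, `hc z := (z.1·a + z.2)·w₀`, `R₀ := ϱ‖w₀‖`, `ϱ := μ₁‖a‖ + ε∕σ`, W31's `hK`∕`hR`∕`hact`∕`hL3` through
  `mem_pencilDisc`, `N := 1`, `(A, R, r₁, b₅) := ((e·K₀(64,8)·9·64)⁻¹, 2κ₀+2, 0, 0)`, W24's `hrate_torus`∕`hsmall_torus`) plus the WINDOW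
  `μ₀ < μ₁`, `‖μ‖ ≤ μ₀`; conclusion LITERAL; `responseEnd_fires_closed`: `≤ 4·K₀(64,8)·σ∕(ε·(μ₁ − μ₀))`;
* §2 GENUINE — `hasDerivAt_actB` (the activity's source derivative at a corner: `A_s·(a·w₀)`); `differentiableAt_locE_actB` (the dressed
  output is holomorphic in the source at every point of the disc — S33 §2 ONCE along the bi-pencil, then the source section);
  **`deriv_locE_actB_eq`**: `deriv (m ↦ E[act(m,s)](X₀)) μ = A_s(μ)·(a·w₀)∕(1 + A_s(μ))` — from `exp E = 1 + A` (W31's `exp_locE_actW` on a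
  neighbourhood of `μ`), the chain rule and `HasDerivAt.unique`; **`deriv_response_eq`**: the response is the DIFFERENCE OF THE TWO
  LOGARITHMIC DERIVATIVES `a·w₀·(A₁∕(1+A₁) − A₀∕(1+A₀))`; **`response_eq_zero_iff`**: at every source `‖μ‖ < μ₁` of the disc the response
  is `0 ↔ a·w₀ = 0` (`A₁ = A₀` would force `e^{w₀} = 1`, i.e. `w₀ = 0` by W31's `eq_zero_of_exp_eq_one`); **`response_live`**; the located
  `example` (`a = w₀ = ½`, `μ₁ = σ = 1`, `ε = 2`, window `μ₀ = ½`, source `μ = ¼`).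

HONEST FRAMING.  A DECIDED TOY ([folklore]; 0 sorry; 0 citations; no `def`, no `def … : Prop`): S61 §2 applied ONCE to W31's
THEOREM-backed instance of row NE5's structural SHAPE `TermHistExpLinear` over `toyCarriers`, read along W84's bi-pencil — NOT Bałaban's
(2.14) terms, NOT a `BiCore` (S61 §3 NOT exercised), NOT the substrate's slot activities; the logarithmic-derivative formula is calculus on
OUR one-cube toy (W24's `exp E[H]({0}) = 1 + H(X₀)`), not a statement about print's cluster expansion; `a`, `w₀`, `μ₁`, `μ₀`, `σ`, `ε`
DISPLAYED — WHICH table direction is the observable's source and which a booked family's content are the owner's READINGS (L-R ∕ L-P);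
`4K₀σ∕(ε(μ₁ − μ₀))` is a READING of S61's dressed response constant on the toy — (B1a) discharged BY THEOREM on the toy's shape, (w5)∕(w6)
NOT discharged on Bałaban's densities; (B1b) ∕ (B3) ∕ (B5) NOT discharged ((B3) = G-ne9p2-5 UNPRINTED, here MET because the weight is
CHOSEN); no numeral of [Balaban1988RGII]; 0 binders instantiated on Bałaban's densities; no wall item; the NE1′ wall wording of record
v1.8 (T4-DAG v48; v49∕v50 carry it verbatim) — words, not kind — does NOT move; R-t4r2-Q2 NOT met thereby; no internally-minted statement
becomes a cited fact (ABSOLUTE RULE).  NE1′ ⇐ the named binders — NOT proved, NOT printed; spine PROVED 0∕9; count 9 unchanged.  Rung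
(B)+1 on ONE finite four-torus — NOT infinite volume, NOT a mass gap, NOT OS on ℝ⁴, NOT Clay.
HONEST DEPENDENCY: continuum YM on T⁴ ⇐ BetaPertH ∧ nine spine estimates (0/9 proved); BetaPertH ⇐ (D1) ∧ (D4) ∧ CAP+tail; G-an2-4
gates asym, D1 and NE2/3/4.
-/

noncomputable section

namespace Summit.QuantumFields.BalabanUV.T4Continuum.NE1p.DressedRebornMuResponseWitness

open Metric Set Complex MeasureTheory Filter
open scoped BigOperators Topology
open Literature.MathematicalPhysics.QuantumFieldTheory.Balaban1983to89.T4InputCauchyRate (toyCarriers)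
open Literature.MathematicalPhysics.QuantumFieldTheory.Balaban1983to89.T4InputCauchyRateSpecies (ballClass toyCtr)
open Literature.MathematicalPhysics.QuantumFieldTheory.Balaban1983to89.B13Resummation (locE)
open Literature.MathematicalPhysics.QuantumFieldTheory.Balaban1983to89.B12TreeDecay (K₀ K₀_pos)
open Literature.MathematicalPhysics.QuantumFieldTheory.Balaban1983to89.TreeLengthTorus (TDom tsys)
open Literature.MathematicalPhysics.QuantumFieldTheory.Balaban1983to89.TreeLengthTorusGeometry (tgeometry)
open Summit.QuantumFields.BalabanUV.T4Continuum.NE1p.DressedSmallFieldGeometry (torus_consts)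
open Summit.QuantumFields.BalabanUV.T4Continuum.NE1p.DressedSmallFieldGeometryFaces (K₀_four)
open Summit.QuantumFields.BalabanUV.T4Continuum.NE1p.DressedSmallFieldTorusWitness (X₀ hsmall_torus hrate_torus prefactor_pos)
open Summit.QuantumFields.BalabanUV.T4Continuum.NE1p.DressedSmallFieldOnCoresWitness (wTerm wMeas wPhi wLam termHistExpLinear_wTerm
  norm_wLam_le terms actW actW_X₀ hact hR hK cW cW_pos hL3 norm_actW_X₀_lt_one exp_locE_actW eq_zero_of_exp_eq_one)
open Summit.QuantumFields.BalabanUV.T4Continuum.NE1p.DressedSourceAnalyticOnCores (analytic_and_bounded_locE_param_of_expLinear)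
open Summit.QuantumFields.BalabanUV.T4Continuum.NE1p.DressedRebornMuPartWitness (actB actB_X₀ mem_pencilDisc differentiableOn_bipencil
  corners_mem norm_exponents_le)
open Summit.QuantumFields.BalabanUV.T4Continuum.NE1p.DressedRebornMuResponse (rebornMuDeriv_locE_le_of_expLinear)

variable (N : ℕ) [NeZero N]

/-! ## §1 THE END FIRES: S61 §2 `rebornMuDeriv_locE_le_of_expLinear` APPLIED ONCE BY NAME on W84's bi-pencil datum -/

open Classical in
/-- **S61 §2's `rebornMuDeriv_locE_le_of_expLinear` FIRES ON W31's EXP-LINEAR DATUM ALONG W84's BI-PENCIL** [decided toy]: `(D, G) :=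
(tsys 4 N, tgeometry 4 N)`; `hexp := termHistExpLinear_wTerm`; `hc z := (z.1·a + z.2)·w₀`; W31's `hK`∕`hR`∕`hact`∕`hL3` BY NAME at the
pencil radius `ϱ := μ₁‖a‖ + ε∕σ` (W84's `mem_pencilDisc`); `N := 1`; `(A, R, r₁, b₅) := ((e·K₀(64,8)·9·64)⁻¹, 2κ₀ + 2, 0, 0)` with W24's
`hrate_torus`∕`hsmall_torus`.  DISPLAYED: `0 < σ < ε`, `ϱ·‖w₀‖ ≤ 2`, the source WINDOW `μ₀ < μ₁`, `‖μ‖ ≤ μ₀`.  Conclusion LITERAL. [folklore] -/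
theorem responseEnd_fires {a w₀ : ℂ} {μ₁ μ₀ σ ε : ℝ} (hσ : 0 < σ) (hσε : σ < ε)
    (hw : (μ₁ * ‖a‖ + ε / σ) * ‖w₀‖ ≤ 2) (h01 : μ₀ < μ₁) (k : ℕ) (g : ℕ → ℝ) {μ : ℂ} (hμ : ‖μ‖ ≤ μ₀) :
    ‖deriv (fun m : ℂ =>
        locE (tgeometry 4 N).ι (tgeometry 4 N).cubes (actB N (μ₁ * ‖a‖ + ε / σ) a w₀ (m, 1)) ((tgeometry 4 N).cubes (X₀ N)) -
          locE (tgeometry 4 N).ι (tgeometry 4 N).cubes (actB N (μ₁ * ‖a‖ + ε / σ) a w₀ (m, 0)) ((tgeometry 4 N).cubes (X₀ N))) μ‖ ≤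
      2 * (2 * (Real.exp 1 * (tgeometry 4 N).ν * (tgeometry 4 N).c₁ * (tgeometry 4 N).K₀ ^ 2 * (Real.exp 1 * K₀ 64 8 * 9 * 64)⁻¹ *
        Real.exp (-(0 * (tsys 4 N).dj (X₀ N)))) / ε * σ) / (μ₁ - μ₀) :=
  rebornMuDeriv_locE_le_of_expLinear (tsys 4 N) (tgeometry 4 N)
    (termHistExpLinear_wTerm (cW (μ₁ * ‖a‖ + ε / σ) w₀) (ballClass toyCtr (fun _ => 1 / 8) fun _ => 2) Set.univ)
    (Set.mem_univ g) (U := ()) (o := 0) (hc := fun z : ℂ × ℂ => (z.1 * a + z.2) * w₀) (R₀ := (μ₁ * ‖a‖ + ε / σ) * ‖w₀‖) hσ hσε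
    (differentiableOn_bipencil a w₀ _) (fun z hz => hK hw k g () (z.1 * a + z.2) (mem_pencilDisc hz))
    (fun z hz => hR (μ₁ * ‖a‖ + ε / σ) w₀ (z.1 * a + z.2) (mem_pencilDisc hz))
    (emb := fun _ => k) (fun _ => rfl) (terms := terms N) (act := actB N (μ₁ * ‖a‖ + ε / σ) a w₀)
    (fun z _ Z => hact N (cW (μ₁ * ‖a‖ + ε / σ) w₀) w₀ k (z.1 * a + z.2) Z) (N := fun _ _ => 1) (fun _ _ => zero_le_one)
    (fun _ i _ => ae_of_all _ fun x => norm_wLam_le k i 0 k x)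
    (A := (Real.exp 1 * K₀ 64 8 * 9 * 64)⁻¹) (R := 2 * (tgeometry 4 N).κ₀ + 2) (r₁ := 0) (b₅ := 0) (X₀ := X₀ N)
    (inv_nonneg.2 prefactor_pos.le) le_rfl (by rw [zero_mul]) (hrate_torus N) (hsmall_torus N)
    (hL3 N (μ₁ * ‖a‖ + ε / σ) w₀ k _) (μ₀ := μ₀) h01 hμ

open Classical in
/-- … in CLOSED FORM: the response of the re-born part is `≤ 4·K₀(64,8)·σ∕(ε·(μ₁ − μ₀))` (`e·ν·c₁·K₀²·A = K₀(64,8)`; decay factor `1`) —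
LINEAR in the content size `σ` with the Cauchy-off-centre window quotient, free of `μ`. [folklore] -/
theorem responseEnd_fires_closed {a w₀ : ℂ} {μ₁ μ₀ σ ε : ℝ} (hσ : 0 < σ) (hσε : σ < ε)
    (hw : (μ₁ * ‖a‖ + ε / σ) * ‖w₀‖ ≤ 2) (h01 : μ₀ < μ₁) (k : ℕ) (g : ℕ → ℝ) {μ : ℂ} (hμ : ‖μ‖ ≤ μ₀) :
    ‖deriv (fun m : ℂ =>
        locE (tgeometry 4 N).ι (tgeometry 4 N).cubes (actB N (μ₁ * ‖a‖ + ε / σ) a w₀ (m, 1)) ((tgeometry 4 N).cubes (X₀ N)) -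
          locE (tgeometry 4 N).ι (tgeometry 4 N).cubes (actB N (μ₁ * ‖a‖ + ε / σ) a w₀ (m, 0)) ((tgeometry 4 N).cubes (X₀ N))) μ‖ ≤
      4 * K₀ 64 8 * σ / (ε * (μ₁ - μ₀)) := by
  have hε : 0 < ε := hσ.trans hσε
  have hgap : 0 < μ₁ - μ₀ := sub_pos.2 h01
  have h := responseEnd_fires N hσ hσε hw h01 k g hμ
  rw [zero_mul, neg_zero, Real.exp_zero, mul_one, K₀_four, (torus_consts N).1, (torus_consts N).2.2] at h
  refine h.trans (le_of_eq ?_)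
  have hK : K₀ (64 : ℝ) 8 ≠ 0 := (K₀_pos _ _).ne'
  have he : Real.exp 1 ≠ 0 := (Real.exp_pos 1).ne'
  field_simp
  ring

/-! ## §2 GENUINE — THE RESPONSE IS A DIFFERENCE OF LOGARITHMIC DERIVATIVES -/

section Genuine
variable {a w₀ : ℂ} {μ₁ σ ε : ℝ}

/-- The activity's source derivative at strength `s`: `∂_m (c·e^{(m·a+s)·w₀}) = A_s(m)·(a·w₀)`. [folklore] -/
theorem hasDerivAt_actB (ϱ : ℝ) (s μ : ℂ) :
    HasDerivAt (fun m : ℂ => actB N ϱ a w₀ (m, s) (X₀ N)) (actB N ϱ a w₀ (μ, s) (X₀ N) * (a * w₀)) μ := by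
  have h1 : HasDerivAt (fun m : ℂ => (m * a + s) * w₀) (a * w₀) μ := ((hasDerivAt_mul_const a).add_const s).mul_const w₀
  have h2 := (h1.cexp).const_mul (cW ϱ w₀ : ℂ)
  simp only [actB_X₀]
  exact h2.congr_deriv (by ring)

open Classical in
/-- **THE DRESSED OUTPUT IS HOLOMORPHIC ALONG THE BI-PENCIL** (S33 §2 `analytic_and_bounded_locE_param_of_expLinear` ONCE, with W84's
plumbing) — the differentiability half of what S56∕S61 §2 consume internally, read out for the datum. [folklore] -/
theorem differentiableOn_locE_actB (hw : (μ₁ * ‖a‖ + ε / σ) * ‖w₀‖ ≤ 2) (k : ℕ) (g : ℕ → ℝ) :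
    DifferentiableOn ℂ (fun z : ℂ × ℂ =>
      locE (tgeometry 4 N).ι (tgeometry 4 N).cubes (actB N (μ₁ * ‖a‖ + ε / σ) a w₀ z) ((tgeometry 4 N).cubes (X₀ N)))
      (ball (0 : ℂ) μ₁ ×ˢ ball (0 : ℂ) (ε / σ)) :=
  (analytic_and_bounded_locE_param_of_expLinear (tsys 4 N) (tgeometry 4 N)
    (termHistExpLinear_wTerm (cW (μ₁ * ‖a‖ + ε / σ) w₀) (ballClass toyCtr (fun _ => 1 / 8) fun _ => 2) Set.univ)
    (Set.mem_univ g) (U := ()) (o := 0) (hc := fun z : ℂ × ℂ => (z.1 * a + z.2) * w₀) (R₀ := (μ₁ * ‖a‖ + ε / σ) * ‖w₀‖)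
    (isOpen_ball.prod isOpen_ball) (differentiableOn_bipencil a w₀ _)
    (fun z hz => hK hw k g () (z.1 * a + z.2) (mem_pencilDisc hz))
    (fun z hz => hR (μ₁ * ‖a‖ + ε / σ) w₀ (z.1 * a + z.2) (mem_pencilDisc hz))
    (emb := fun _ => k) (fun _ => rfl) (terms := terms N) (act := actB N (μ₁ * ‖a‖ + ε / σ) a w₀)
    (fun z _ Z => hact N (cW (μ₁ * ‖a‖ + ε / σ) w₀) w₀ k (z.1 * a + z.2) Z) (N := fun _ _ => 1) (fun _ _ => zero_le_one)
    (fun _ i _ => ae_of_all _ fun x => norm_wLam_le k i 0 k x)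
    (A := (Real.exp 1 * K₀ 64 8 * 9 * 64)⁻¹) (R := 2 * (tgeometry 4 N).κ₀ + 2) (r₁ := 0) (b₅ := 0) (X₀ := X₀ N)
    (inv_nonneg.2 prefactor_pos.le) le_rfl (by rw [zero_mul]) (hrate_torus N) (hsmall_torus N)
    (hL3 N (μ₁ * ‖a‖ + ε / σ) w₀ k _)).1

open Classical in
/-- The source section at a strength `s` of the disc is holomorphic at every source `‖μ‖ < μ₁`. [folklore] -/
theorem differentiableAt_locE_actB (hw : (μ₁ * ‖a‖ + ε / σ) * ‖w₀‖ ≤ 2) (k : ℕ) (g : ℕ → ℝ)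
    {s : ℂ} (hs : s ∈ ball (0 : ℂ) (ε / σ)) {μ : ℂ} (hμ : ‖μ‖ < μ₁) :
    DifferentiableAt ℂ (fun m : ℂ =>
      locE (tgeometry 4 N).ι (tgeometry 4 N).cubes (actB N (μ₁ * ‖a‖ + ε / σ) a w₀ (m, s)) ((tgeometry 4 N).cubes (X₀ N))) μ := by
  have hsec : DifferentiableOn ℂ (fun m : ℂ =>
      locE (tgeometry 4 N).ι (tgeometry 4 N).cubes (actB N (μ₁ * ‖a‖ + ε / σ) a w₀ (m, s)) ((tgeometry 4 N).cubes (X₀ N)))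
      (ball (0 : ℂ) μ₁) :=
    (differentiableOn_locE_actB N hw k g).comp (differentiableOn_id.prodMk (differentiableOn_const s))
      fun m hm => ⟨hm, hs⟩
  exact hsec.differentiableAt (isOpen_ball.mem_nhds (mem_ball_zero_iff.2 hμ))

open Classical in
/-- W24's `exp E[H]({0}) = 1 + H(X₀)` at a bi-pencil point (W31's `exp_locE_actW`), for points inside the pencil disc and a live `w₀`. [folklore] -/
theorem exp_locE_actB {ϱ : ℝ} {m s : ℂ} (h : ‖m * a + s‖ < ϱ) (hw0 : w₀ ≠ 0) :
    cexp (locE (tgeometry 4 N).ι (tgeometry 4 N).cubes (actB N ϱ a w₀ (m, s)) ((tgeometry 4 N).cubes (X₀ N))) =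
      1 + actB N ϱ a w₀ (m, s) (X₀ N) :=
  exp_locE_actW N h hw0

open Classical in
/-- **THE SOURCE DERIVATIVE OF THE DRESSED OUTPUT IS THE LOGARITHMIC DERIVATIVE OF `1 + A`** [decided toy]: at a source `‖μ‖ < μ₁` of the
disc and a strength `s` of the disc with the corner `μ·a + s` inside the pencil disc, `deriv (m ↦ E[act(m,s)](X₀)) μ = A_s(μ)·(a·w₀)∕(1 + A_s(μ))`
— `exp E = 1 + A` on a neighbourhood of `μ` (the pencil-disc condition is OPEN), the chain rule `(exp E)' = exp E · E'`, the activity's own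
derivative (`hasDerivAt_actB`) and the uniqueness of derivatives; no branch of `log` is chosen. [folklore] -/
theorem deriv_locE_actB_eq (hw : (μ₁ * ‖a‖ + ε / σ) * ‖w₀‖ ≤ 2) (hw0 : w₀ ≠ 0) (k : ℕ) (g : ℕ → ℝ)
    {s : ℂ} (hs : s ∈ ball (0 : ℂ) (ε / σ)) {μ : ℂ} (hμ : ‖μ‖ < μ₁) (hcorner : ‖μ * a + s‖ < μ₁ * ‖a‖ + ε / σ) :
    deriv (fun m : ℂ =>
        locE (tgeometry 4 N).ι (tgeometry 4 N).cubes (actB N (μ₁ * ‖a‖ + ε / σ) a w₀ (m, s)) ((tgeometry 4 N).cubes (X₀ N))) μ =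
      actB N (μ₁ * ‖a‖ + ε / σ) a w₀ (μ, s) (X₀ N) * (a * w₀) / (1 + actB N (μ₁ * ‖a‖ + ε / σ) a w₀ (μ, s) (X₀ N)) := by
  set L : ℂ → ℂ := fun m : ℂ =>
    locE (tgeometry 4 N).ι (tgeometry 4 N).cubes (actB N (μ₁ * ‖a‖ + ε / σ) a w₀ (m, s)) ((tgeometry 4 N).cubes (X₀ N)) with hL
  have hdiff : DifferentiableAt ℂ L μ := differentiableAt_locE_actB N hw k g hs hμ
  -- `exp L = 1 + A` on a neighbourhood of `μ`
  have hopen : IsOpen {m : ℂ | ‖m * a + s‖ < μ₁ * ‖a‖ + ε / σ} :=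
    isOpen_lt (continuous_norm.comp ((continuous_id.mul continuous_const).add continuous_const)) continuous_const
  have hev : (fun m : ℂ => 1 + actB N (μ₁ * ‖a‖ + ε / σ) a w₀ (m, s) (X₀ N)) =ᶠ[𝓝 μ] fun m : ℂ => cexp (L m) :=
    Filter.eventually_of_mem (hopen.mem_nhds hcorner) fun m hm => (exp_locE_actB N hm hw0).symm
  have h1 : HasDerivAt (fun m : ℂ => cexp (L m)) (cexp (L μ) * deriv L μ) μ := hdiff.hasDerivAt.cexp
  have h2 : HasDerivAt (fun m : ℂ => 1 + actB N (μ₁ * ‖a‖ + ε / σ) a w₀ (m, s) (X₀ N))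
      (actB N (μ₁ * ‖a‖ + ε / σ) a w₀ (μ, s) (X₀ N) * (a * w₀)) μ := (hasDerivAt_actB N _ s μ).const_add 1
  have huniq : cexp (L μ) * deriv L μ = actB N (μ₁ * ‖a‖ + ε / σ) a w₀ (μ, s) (X₀ N) * (a * w₀) :=
    (h1.congr_of_eventuallyEq hev).unique h2
  rw [exp_locE_actB N hcorner hw0] at huniq
  have hne : (1 : ℂ) + actB N (μ₁ * ‖a‖ + ε / σ) a w₀ (μ, s) (X₀ N) ≠ 0 := fun h => by
    have hA : actB N (μ₁ * ‖a‖ + ε / σ) a w₀ (μ, s) (X₀ N) = -1 := by linear_combination h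
    have hlt : ‖actB N (μ₁ * ‖a‖ + ε / σ) a w₀ (μ, s) (X₀ N)‖ < 1 := norm_actW_X₀_lt_one N hcorner hw0
    rw [hA, norm_neg, norm_one] at hlt
    exact lt_irrefl _ hlt
  rw [eq_div_iff hne, mul_comm]
  exact huniq

open Classical in
/-- **THE RESPONSE OF THE RE-BORN PART IS THE DIFFERENCE OF THE TWO LOGARITHMIC DERIVATIVES** [decided toy]: at every source `‖μ‖ < μ₁`
of the disc (live content `w₀ ≠ 0`), `deriv (m ↦ E[act(m,1)](X₀) − E[act(m,0)](X₀)) μ = a·w₀·(A₁∕(1+A₁) − A₀∕(1+A₀))`,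
`A_s = actB … (μ, s) X₀`. [folklore] -/
theorem deriv_response_eq (hσ : 0 < σ) (hσε : σ < ε) (hw : (μ₁ * ‖a‖ + ε / σ) * ‖w₀‖ ≤ 2) (hw0 : w₀ ≠ 0) (k : ℕ) (g : ℕ → ℝ)
    {μ : ℂ} (hμ : ‖μ‖ < μ₁) :
    deriv (fun m : ℂ =>
        locE (tgeometry 4 N).ι (tgeometry 4 N).cubes (actB N (μ₁ * ‖a‖ + ε / σ) a w₀ (m, 1)) ((tgeometry 4 N).cubes (X₀ N)) -
          locE (tgeometry 4 N).ι (tgeometry 4 N).cubes (actB N (μ₁ * ‖a‖ + ε / σ) a w₀ (m, 0)) ((tgeometry 4 N).cubes (X₀ N))) μ =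
      a * w₀ * (actB N (μ₁ * ‖a‖ + ε / σ) a w₀ (μ, 1) (X₀ N) / (1 + actB N (μ₁ * ‖a‖ + ε / σ) a w₀ (μ, 1) (X₀ N)) -
        actB N (μ₁ * ‖a‖ + ε / σ) a w₀ (μ, 0) (X₀ N) / (1 + actB N (μ₁ * ‖a‖ + ε / σ) a w₀ (μ, 0) (X₀ N))) := by
  obtain ⟨c11, -, c10, -⟩ := corners_mem (a := a) hσ hσε hμ
  have hε : 0 < ε / σ := div_pos (hσ.trans hσε) hσ
  have h1 : (1 : ℂ) ∈ ball (0 : ℂ) (ε / σ) := by rw [mem_ball_zero_iff, norm_one]; exact (one_lt_div hσ).2 hσε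
  have h0 : (0 : ℂ) ∈ ball (0 : ℂ) (ε / σ) := mem_ball_self hε
  rw [add_zero] at c10
  have d1 := differentiableAt_locE_actB N hw k g h1 hμ
  have d0 := differentiableAt_locE_actB N hw k g h0 hμ
  have e1 := deriv_locE_actB_eq N hw hw0 k g h1 hμ c11
  have e0 := deriv_locE_actB_eq N hw hw0 k g h0 hμ (by rw [add_zero]; exact c10)
  rw [deriv_fun_sub d1 d0, e1, e0]
  ring

/-- The two corner activities differ by the content factor: `A₁ − A₀ = c·e^{μ·a·w₀}·(e^{w₀} − 1)`. [folklore] -/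
theorem actB_one_sub_zero (ϱ : ℝ) (μ : ℂ) :
    actB N ϱ a w₀ (μ, 1) (X₀ N) - actB N ϱ a w₀ (μ, 0) (X₀ N) = (cW ϱ w₀ : ℂ) * cexp (μ * a * w₀) * (cexp w₀ - 1) := by
  simp only [actB_X₀]
  rw [show (μ * a + 1) * w₀ = μ * a * w₀ + w₀ by ring, Complex.exp_add, show (μ * a + 0) * w₀ = μ * a * w₀ by ring]
  ring

open Classical in
/-- **THE RESPONSE VANISHES AT A SOURCE IFF THE SOURCE DIRECTION OR THE CONTENT IS DEAD** [decided toy]: at every source `‖μ‖ < μ₁` of the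
disc (booked bidisc, `w₀ ≠ 0`), the response is `0 ↔ a·w₀ = 0` — i.e. `↔ a = 0` for a live content.  (⇒) with `a·w₀ ≠ 0` the two
logarithmic derivatives would agree, `A₁·(1+A₀) = A₀·(1+A₁)`, i.e. `A₁ = A₀`, so `c·e^{μaw₀}·(e^{w₀} − 1) = 0` and `e^{w₀} = 1` — impossible
for `0 < ‖w₀‖ ≤ 2` (W31's `eq_zero_of_exp_eq_one`).  (⇐) the factor `a·w₀`. [folklore] -/
theorem response_eq_zero_iff (hσ : 0 < σ) (hσε : σ < ε) (hw : (μ₁ * ‖a‖ + ε / σ) * ‖w₀‖ ≤ 2) (hw0 : w₀ ≠ 0) (k : ℕ) (g : ℕ → ℝ)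
    {μ : ℂ} (hμ : ‖μ‖ < μ₁) :
    deriv (fun m : ℂ =>
        locE (tgeometry 4 N).ι (tgeometry 4 N).cubes (actB N (μ₁ * ‖a‖ + ε / σ) a w₀ (m, 1)) ((tgeometry 4 N).cubes (X₀ N)) -
          locE (tgeometry 4 N).ι (tgeometry 4 N).cubes (actB N (μ₁ * ‖a‖ + ε / σ) a w₀ (m, 0)) ((tgeometry 4 N).cubes (X₀ N))) μ = 0 ↔
      a * w₀ = 0 := by
  rw [deriv_response_eq N hσ hσε hw hw0 k g hμ]
  obtain ⟨c11, -, c10, -⟩ := corners_mem (a := a) hσ hσε hμ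
  set A1 := actB N (μ₁ * ‖a‖ + ε / σ) a w₀ (μ, 1) (X₀ N) with hA1
  set A0 := actB N (μ₁ * ‖a‖ + ε / σ) a w₀ (μ, 0) (X₀ N) with hA0
  have n1 : (1 : ℂ) + A1 ≠ 0 := fun h => by
    have hA : A1 = -1 := by linear_combination h
    have hlt : ‖A1‖ < 1 := norm_actW_X₀_lt_one N c11 hw0
    rw [hA, norm_neg, norm_one] at hlt
    exact lt_irrefl _ hlt
  have n0 : (1 : ℂ) + A0 ≠ 0 := fun h => by
    have hA : A0 = -1 := by linear_combination h
    have hlt : ‖A0‖ < 1 := norm_actW_X₀_lt_one N c10 hw0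
    rw [hA, norm_neg, norm_one] at hlt
    exact lt_irrefl _ hlt
  constructor
  · intro h
    by_contra haw
    have hq : A1 / (1 + A1) - A0 / (1 + A0) = 0 := by
      rcases mul_eq_zero.1 h with h' | h'
      · exact absurd h' haw
      · exact h'
    have hq' : A1 * (1 + A0) - A0 * (1 + A1) = 0 := by
      have := hq
      field_simp at this
      linear_combination this
    have hdiff : A1 - A0 = 0 := by linear_combination hq'
    rw [hA1, hA0, actB_one_sub_zero] at hdiff
    have hc : (cW (μ₁ * ‖a‖ + ε / σ) w₀ : ℂ) ≠ 0 := by exact_mod_cast (cW_pos _ w₀).ne'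
    rcases mul_eq_zero.1 hdiff with h' | h'
    · rcases mul_eq_zero.1 h' with h'' | h''
      · exact hc h''
      · exact Complex.exp_ne_zero _ h''
    · obtain ⟨-, hn2⟩ := norm_exponents_le (a := a) (μ := μ) hσ hσε hw hμ
      exact hw0 (eq_zero_of_exp_eq_one hn2 (sub_eq_zero.1 h'))
  · intro h
    rw [h, zero_mul]

open Classical in
/-- **GENUINE — THE RESPONSE OF THE RE-BORN PART IS LIVE AT EVERY SOURCE OF THE DISC** [decided toy]: for a live source direction `a ≠ 0`
and a live content `w₀ ≠ 0` (booked bidisc), the source derivative bounded by `responseEnd_fires` is `≠ 0` at EVERY `‖μ‖ < μ₁` — unlike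
W84's mixed difference, which vanishes at the base source `μ = 0`. [folklore] -/
theorem response_live (hσ : 0 < σ) (hσε : σ < ε) (hw : (μ₁ * ‖a‖ + ε / σ) * ‖w₀‖ ≤ 2) (hw0 : w₀ ≠ 0) (ha : a ≠ 0) (k : ℕ)
    (g : ℕ → ℝ) {μ : ℂ} (hμ : ‖μ‖ < μ₁) :
    deriv (fun m : ℂ =>
        locE (tgeometry 4 N).ι (tgeometry 4 N).cubes (actB N (μ₁ * ‖a‖ + ε / σ) a w₀ (m, 1)) ((tgeometry 4 N).cubes (X₀ N)) -
          locE (tgeometry 4 N).ι (tgeometry 4 N).cubes (actB N (μ₁ * ‖a‖ + ε / σ) a w₀ (m, 0)) ((tgeometry 4 N).cubes (X₀ N))) μ ≠ 0 :=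
  fun h => (mul_ne_zero ha hw0) ((response_eq_zero_iff N hσ hσε hw hw0 k g hμ).1 h)

open Classical in
/-- **THE END FIRES ON A LIVE DATUM, AT THE BASE SOURCE TOO** [located]: `a = w₀ = ½`, `μ₁ = σ = 1`, `ε = 2` (W84's located datum,
`ϱ‖w₀‖ = 5∕4 ≤ 2`), window `μ₀ = ½`: S61 §2's closed bound `4·K₀(64,8)·1∕(2·(1 − ½))` at the source `μ = ¼`, and the response `≠ 0` at the
base source `μ = 0` (where W84's mixed difference vanishes). -/
example (k : ℕ) (g : ℕ → ℝ) :
    ‖deriv (fun m : ℂ =>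
        locE (tgeometry 4 N).ι (tgeometry 4 N).cubes (actB N (1 * ‖(1 / 2 : ℂ)‖ + 2 / 1) (1 / 2) (1 / 2) (m, 1))
            ((tgeometry 4 N).cubes (X₀ N)) -
          locE (tgeometry 4 N).ι (tgeometry 4 N).cubes (actB N (1 * ‖(1 / 2 : ℂ)‖ + 2 / 1) (1 / 2) (1 / 2) (m, 0))
            ((tgeometry 4 N).cubes (X₀ N))) ((1 / 4 : ℂ))‖ ≤ 4 * K₀ 64 8 * 1 / (2 * (1 - 1 / 2)) ∧
      deriv (fun m : ℂ =>
        locE (tgeometry 4 N).ι (tgeometry 4 N).cubes (actB N (1 * ‖(1 / 2 : ℂ)‖ + 2 / 1) (1 / 2) (1 / 2) (m, 1))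
            ((tgeometry 4 N).cubes (X₀ N)) -
          locE (tgeometry 4 N).ι (tgeometry 4 N).cubes (actB N (1 * ‖(1 / 2 : ℂ)‖ + 2 / 1) (1 / 2) (1 / 2) (m, 0))
            ((tgeometry 4 N).cubes (X₀ N))) (0 : ℂ) ≠ 0 := by
  have hw : ((1 : ℝ) * ‖(1 / 2 : ℂ)‖ + 2 / 1) * ‖(1 / 2 : ℂ)‖ ≤ 2 := by norm_num
  exact ⟨responseEnd_fires_closed N one_pos (by norm_num) hw (by norm_num) k g (by norm_num),
    response_live N one_pos (by norm_num) hw (by norm_num) (by norm_num) k g (by norm_num)⟩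

end Genuine

end Summit.QuantumFields.BalabanUV.T4Continuum.NE1p.DressedRebornMuResponseWitness

end
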